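import Summits.ValiantsHypothesis.ValiantsHypothesis.Theorems.KPlusLogSqLawTropicalBThreeFiveTree2
import Summits.ValiantsHypothesis.ValiantsHypothesis.Theorems.KPlusLogSqLawTropicalBNormalForm

/-!
# Route «KPlusLogSqLaw», crux `TropicalB` (stmt-ValiantsHypothesis-19771) — THE `(3,5)` TROPICAL ROW IS NOT COUNTING-TIGHT:
# `TropRootLawAt 3 5 33`, i.e. `T(3,5) ≤ 33` (row of record before: `27 ≤ T(3,5) ≤ 34 = C(7,3) − 1`)

HONEST FRAMING.  Helper / census theorem toward the crux `Summit.ValiantsHypothesis.ValiantsHypothesis.Theses.KPlusLogSqLaw.TropicalB`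
(ledger item `stmt-ValiantsHypothesis-19771`; cell `pub-symmetroid`, seat val-sym-trop-p4 g5, 2026-08-27; `--supports … --as helper`).  A SMALL-
FORMAT census value (`m = 3`, `K = 5`), far inside the crux's known regime; nothing here bears on `TropicalB` in its window, `WeakLifting`,
DoorA26/DoorA34, `MatrixDescartes` (stmt-ValiantsHypothesis-18050) or VP ≠ VNP.

THEOREM (`tropRootLawAt_three_five : TropRootLawAt 3 5 33`).  Every sign-alternating chain of dominant terms of every `3 × 3` dominance design
with `5` slope classes has at most `33` sign changes — one less than slope counting (`TropicalCensus.tropRootLawAt_choose`: `34`); the `(3,4)`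
row IS counting-tight (`T(3,4) = 19`, p431254), so `(3,5)` is the first `m = 3` format that is not.  Lower side of record: `27 ≤ T(3,5)`.

PROOF (all in the kernel; this file is the root).  Normal form (`exists_normalized_chain`, val-sym-trop-p3): exponents strictly increasing on
`K' ≤ 5` classes (`le_33_of_strictMono_le`); `K' ≤ 4` is slope counting (`C(K'+2,3) − 1 ≤ 19`).  For `K' = 5` the decision tree `ThreeFive.tree` (files `…ThreeFiveTree1/2`,
88 leaves, depth ≤ 9) splits on trichotomies of slope comparisons between class multisets; an equality closes by a TIE lemma (two distinct
histograms of equal slope cannot both occur among the 35 pairwise distinct histograms of a 34-change chain, `ThreeFive.le_33_of_tie₃`); each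
strict leaf is one of 61 CERTIFICATES `ThreeFive.cert_*` (files `…ThreeFiveCert1..6`): a set of 4–6 histograms that — given the leaf's slope
relations — no dominant chain can carry in slope order, by kernel evaluation (`decide`) of the order-type pairwise-law search `ThreeFive.search1`
whose soundness (`…ThreeFiveKit`, `…ThreeFiveBound`) is the tree's cyclewise exchange law `sum_d_lt_of_isDominant_invariant` (conjb-2 / val-sym-
trop-p4) plus the row relabelling `isDominant_relabel_iff` (val-sym-trop-p1).  The tree and the certificates were found by the seat's exact
located computation (memo HOME/val-sym-trop-p4/g5/THREE-FIVE-g5.md: 1520-cell arrangement, hypothesis-minimised unsat cores, rational BSP for the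
cover); the kernel now checks every step.  [this cell]
-/

-- `Summit.ValiantsHypothesis.ValiantsHypothesis.…` repeats a component by the D-0017 layout
-- (single-conjunct summit), which the `dupNamespace` linter flags; the name is mandated.
set_option linter.dupNamespace false
set_option autoImplicit false

namespace Summit.ValiantsHypothesis.ValiantsHypothesis.Theorems.KPlusLogSqLaw

open Summit.ValiantsHypothesis.ValiantsHypothesis.Theorems.MatrixDescartes.Negative
open Summit.ValiantsHypothesis.ValiantsHypothesis.Theorems.LacunarySymmetroidMatrixDescartes.TropicalCensus
open Finset ForbiddenPatterns

namespace ThreeFive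

/-- **`T(3,K) ≤ 33` for every `K ≤ 5` and strictly increasing exponents** (`K ≤ 4`: slope counting). -/
theorem le_33_of_strictMono_le {K : ℕ} (hK : K ≤ 5) (d : Fin K → ℕ) (hd : StrictMono d)
    (v ε : Fin 3 → Fin 3 → Fin K → ℤ) (n : ℕ) (θ : Fin (n + 1) → ℤ) (p : Fin (n + 1) → Equiv.Perm (Fin 3) × (Fin 3 → Fin K))
    (hε : ∀ i j l, (ε i j l).natAbs ≤ 1) (hθ : StrictMono θ) (hdom : ∀ k, IsDominant d v ε (θ k) (p k))
    (halt : ∀ k : Fin n, termSign ε (p k.castSucc) * termSign ε (p k.succ) < 0) : n ≤ 33 := by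
  rcases Nat.lt_or_ge K 5 with hlt | hge
  · have h := tropRootLawAt_choose 3 K d v ε n θ p hε hθ hdom halt
    have hb : (K + 3 - 1).choose 3 - 1 ≤ 33 := by
      interval_cases K <;> decide
    exact h.trans hb
  · obtain rfl : K = 5 := le_antisymm hK hge
    exact tree d hd v ε n θ p hθ hdom halt

/-- **THE `(3,5)` ROW: `TropRootLawAt 3 5 33`** — every sign-alternating dominant chain of a `(3,5)` design has at most `33` sign changes
(slope counting gives `34`; `(3,5)` is not counting-tight).  [this cell, val-sym-trop-p4 g5] -/
theorem tropRootLawAt_three_five : TropRootLawAt 3 5 33 := by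
  intro d v ε n θ p hε hθ hdom halt
  obtain ⟨d', v', ε', p', hsm, -, hε', -, hsign, hdom'⟩ := exists_normalized_chain d v ε hε θ p hdom
  have halt' : ∀ k : Fin n, termSign ε' (p' k.castSucc) * termSign ε' (p' k.succ) < 0 := fun k => by
    rw [hsign, hsign]; exact halt k
  have hK : (univ.image d).card ≤ 5 := (Finset.card_image_le).trans (by simp)
  exact le_33_of_strictMono_le hK d' hsm v' ε' n θ p' hε' hθ hdom' halt'

/-- the `(3,5)` row against slope counting: `33 < 34 = C(7,3) − 1`. -/
theorem three_five_lt_counting : 33 < (5 + 3 - 1).choose 3 - 1 := by decide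

end ThreeFive

end Summit.ValiantsHypothesis.ValiantsHypothesis.Theorems.KPlusLogSqLaw
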